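import Literature.NumberTheory.Transcendental.PadicCW77Main
import Summits.ABC.StewartYu.PadicCW77HalfStep
import Summits.ABC.StewartYu.PadicW80SizesC
import Summits.ABC.StewartYu.PadicW80Budgets
import Summits.ABC.StewartYu.DescentSizesQ
import HarnessLib

/-!
# Cell abc-stewartyu, junction J3: p2's input `HalfStep` from half-point sizes and the half-point
# inequality, and the half-point sizes in closed form

`Summits/ABC/StewartYu/PadicCW77Junctions.lean` — cell `abc-stewartyu` (HOME
`run/shared/lean/pub/abc-stewartyu/`, seat p3; two plain `Prop` definitions in p2's style + theorems,
no named fact), on top of p2's `PadicCW77Main.lean` (`Inv`, `HalfStep`, `norm_Φ_le_of_zeros`),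
p3's `PadicCW77HalfStep.lean` (`toQ`, `inv_succ_of_norm_Φ_half_lt`), `PadicW80SizesC.lean`
(`Dhalf_le_p`, `abs_rHalf_le_p`), `PadicW80Budgets.lean` (`DmaxHp`, `MmaxHp`) and `DescentSizesQ.lean`.

* `HSizesHalf` (archimedean sizes at the half points: `Dhalf♭ ≤ DmaxH`, `∑|classVec| ≤ MmaxH`) and
  `HFinalHalf` (the half-point inequality of the parameters, sharp branch-1 form
  `p^{⌊hL_b/(p−1)⌋}‖Λ₀‖p^{⌊(t−1)/(p−1)⌋}p^{condExp}`) — the two named WP-A4 targets;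
* **`halfStep_of`** — `hind` (Kummer on the signed generators) + `‖Λ₀‖ ≤ p⁻¹` + the room
  `T/2^{J+1} + t ≤ T/2^J − d·t` + `HSizesHalf` + `HFinalHalf J` ⟹ `S.HalfStep J₀ J L Lθ S₀ T t P`
  (p2's `norm_Φ_le_of_zeros` at `z = 2⁻¹·s`, then `inv_succ_of_norm_Φ_half_lt`);
* `hFinalHalf_of_log_ineq` — two real inequalities between logarithms ⟹ `HFinalHalf`;
* **`hSizesHalf_of_hyp`** — under the height link `hy : S.toQ.flat.SizeHyp P.Vs P.Vel P.Wb`,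
  `HSizesHalf` holds with `DmaxHp = 𝔅²E(2)`, `MmaxHp = 𝔅·PrV·𝔅²E(2)` for `|p| ≤ Pint ≤ PrV`.

Everything is [folklore].
-/

noncomputable section

open NormedSpace Finset
open Literature.NumberTheory.Transcendental
open Literature.NumberTheory.Transcendental.CW77 (heightProd)
open Literature.NumberTheory.Transcendental.CW77.Setup (Idx Tau tauNorm)

namespace Literature.NumberTheory.Transcendental.PadicCW77.Setup

open Summit.ABC.StewartYu
open Summit.ABC.StewartYu.PadicW80Par (cLp')

variable (S : PadicCW77.Setup) {h Lb : ℕ}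

/-- **Archimedean sizes at the half points of level `J`** (WP-A4 target, from the heights: `Dhalf♭`
of the flattening and the `ℓ¹`-norm of the signed class-sum vector for every admissible `p`).
[folklore] -/
def HSizesHalf (J₀ J : ℕ) (L : Fin S.d → ℕ) (Lθ S₀ T : ℕ) (P : ℤ) (DmaxH MmaxH : ℝ) : Prop :=
  1 ≤ MmaxH ∧ ∀ p : Idx S.d h Lb → ℤ, S.Inv J₀ L Lθ S₀ T P J p →
    ∀ s, s < 2 ^ (J + 1) * S₀ → Odd s → ∀ τ : Tau S.d, tauNorm τ < T / 2 ^ (J + 1) →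
      ((S.toQ.flat.Dhalf (h := h) J₀ J L Lθ s τ : ℕ) : ℝ) ≤ DmaxH ∧
      ∑ T', |(S.toQ.classVec J₀ J (S.toQ.flat.box (h := h) (Lb := Lb) L Lθ J) p τ s T' : ℝ)| ≤ MmaxH

/-- **The half-point inequality of the parameters at level `J`** (WP-A4 target, twin of
`W80Par.final_half`): the Schwarz bound at `kpts = 2^{d+J} S₀/2` nodes of multiplicity `t` is below
the sharp `p`-adic Liouville bound of the class sums. [folklore] -/
def HFinalHalf (J : ℕ) (S₀ t : ℕ) (DmaxH MmaxH : ℝ) : Prop :=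
  max ((S.p : ℝ) ^ (h * Lb / (S.p - 1)) * ‖S.Λ₀‖ * (S.p : ℝ) ^ ((t - 1) / (S.p - 1)) *
        (S.p : ℝ) ^ condExp S.p (2 ^ (S.d + J) * S₀ / 2) t)
      ((S.p : ℝ) ^ (h * Lb) / Real.sqrt S.p ^ ((2 ^ (S.d + J) * S₀ / 2) * t)) <
    DmaxH / (4 * DmaxH ^ 2 * MmaxH * heightProd S.all ^ 3) ^ (2 ^ (S.d + 1))

/-- **J3: the half step from sizes and the half-point inequality.** [folklore] -/
theorem halfStep_of {J₀ J : ℕ} (hJ : J < J₀)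
    (hind : ∀ T' : Finset (Fin (S.d + 1)), T'.Nonempty → ¬ IsSquare (∏ i ∈ T', S.all i))
    (hΛ : ‖S.Λ₀‖ ≤ (S.p : ℝ)⁻¹) {L : Fin S.d → ℕ} {Lθ S₀ T t : ℕ} {P : ℤ} (ht : 1 ≤ t)
    (hS₀ : Even S₀) (hroom : T / 2 ^ (J + 1) + t ≤ T / 2 ^ J - S.d * t) {DmaxH MmaxH : ℝ}
    (hsz : S.HSizesHalf (h := h) (Lb := Lb) J₀ J L Lθ S₀ T P DmaxH MmaxH)
    (hfin : S.HFinalHalf (h := h) (Lb := Lb) J S₀ t DmaxH MmaxH) :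
    S.HalfStep (h := h) (Lb := Lb) J₀ J L Lθ S₀ T t P := by
  intro p inv hvan
  have invQ : S.toQ.Inv J₀ L Lθ S₀ T P J p := ⟨inv.supp, inv.nonzero, inv.bound, inv.rel⟩
  -- the smallness at the half points from the ultrametric Schwarz lemma
  have hsmall : ∀ s, s < 2 ^ (J + 1) * S₀ → Odd s → ∀ τ : Tau S.d, tauNorm τ < T / 2 ^ (J + 1) →
      ‖S.Φ J₀ J (S.toQ.flat.box (h := h) (Lb := Lb) L Lθ J) p τ ((2 : ℚ_[S.p])⁻¹ * (s : ℚ_[S.p]))‖ <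
        DmaxH / (4 * DmaxH ^ 2 * MmaxH * heightProd S.all ^ 3) ^ (2 ^ (S.d + 1)) := by
    intro s hs hodd τ hτ
    have hzero : ∀ i < 2 ^ (S.d + J) * S₀ / 2, ∀ τ'' : Tau S.d, tauNorm τ'' < T / 2 ^ J - S.d * t →
        S.coreSum J₀ J (S.toQ.flat.box (h := h) (Lb := Lb) L Lθ J) p τ'' (2 * i + 1) = 0 := by
      intro i hi τ'' hτ''
      obtain ⟨m, hm⟩ := hS₀
      have h2i : 2 * i + 1 < 2 ^ (S.d + J) * S₀ := by omega
      exact hvan (2 * i + 1) h2i ⟨i, rfl⟩ τ'' hτ''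
    have hz : ‖(2 : ℚ_[S.p])⁻¹ * (s : ℚ_[S.p])‖ ≤ 1 := by
      rw [norm_mul, norm_inv, PadicExp.norm_two_eq_one S.hp3, inv_one, one_mul]
      exact_mod_cast Padic.norm_int_le_one (p := S.p) (s : ℤ)
    have hτt : tauNorm τ + t ≤ T / 2 ^ J - S.d * t := by omega
    have key := (S.norm_Φ_le_of_zeros J₀ J (S.toQ.flat.box (h := h) (Lb := Lb) L Lθ J) p ht hzero hΛ hz τ hτt).2
    exact lt_of_le_of_lt key hfin
  obtain ⟨p', h'⟩ := S.inv_succ_of_norm_Φ_half_lt hJ hind invQ hsz.1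
    (fun s hs ho τ hτ => (hsz.2 p inv s hs ho τ hτ).1) (fun s hs ho τ hτ => (hsz.2 p inv s hs ho τ hτ).2) hsmall
  exact ⟨p', ⟨h'.supp, h'.nonzero, h'.bound, h'.rel⟩⟩

/-! ### `HFinalHalf` in logarithmic form (the WP-A4 target, twin of p2's `kFinal_of_log_ineq`) -/

/-- `(√p)^n = exp((n/2) log p)`. [folklore] -/
private theorem sqrt_pow_eq_exp' (n : ℕ) :
    Real.sqrt S.p ^ n = Real.exp ((n : ℝ) / 2 * Real.log S.p) := by
  have hp0 : (0 : ℝ) < S.p := by exact_mod_cast S.hp.pos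
  rw [Real.sqrt_eq_rpow, ← Real.rpow_natCast, ← Real.rpow_mul hp0.le, Real.rpow_def_of_pos hp0]
  congr 1; ring

/-- `p^n = exp(n log p)`. [folklore] -/
private theorem natPow_eq_exp' (n : ℕ) : (S.p : ℝ) ^ n = Real.exp ((n : ℝ) * Real.log S.p) := by
  have hp0 : (0 : ℝ) < S.p := by exact_mod_cast S.hp.pos
  rw [← Real.rpow_natCast, Real.rpow_def_of_pos hp0]; congr 1; ring

/-- **`HFinalHalf` from two inequalities between logarithms** (the form in which WP-A4 verifies it):
with `kpts = 2^{d+J} S₀/2` and `B = 2^{d+1}·log(4·DmaxH²·MmaxH·(∏H(allᵢ))³) − log DmaxH`, if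
`‖Λ₀‖_p ≤ e^{−U}`, (1) `(⌊hLb/(p−1)⌋ + ⌊(t−1)/(p−1)⌋ + condExp)·log p + B < U` and
(2) `hLb·log p + B < (kpts·t/2)·log p`, then `HFinalHalf J S₀ t DmaxH MmaxH`. [folklore] -/
theorem hFinalHalf_of_log_ineq {U : ℝ} (J S₀ t : ℕ) {DmaxH MmaxH : ℝ}
    (hΛ : ‖S.Λ₀‖ ≤ Real.exp (-U)) (hD : 0 < DmaxH) (hM : 0 < MmaxH)
    (h1 : ((h * Lb / (S.p - 1) + (t - 1) / (S.p - 1) + condExp S.p (2 ^ (S.d + J) * S₀ / 2) t : ℕ) : ℝ) *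
          Real.log S.p +
        ((2 : ℝ) ^ (S.d + 1) * Real.log (4 * DmaxH ^ 2 * MmaxH * heightProd S.all ^ 3) -
          Real.log DmaxH) < U)
    (h2 : ((h * Lb : ℕ) : ℝ) * Real.log S.p +
        ((2 : ℝ) ^ (S.d + 1) * Real.log (4 * DmaxH ^ 2 * MmaxH * heightProd S.all ^ 3) -
          Real.log DmaxH) <
        (((2 ^ (S.d + J) * S₀ / 2) * t : ℕ) : ℝ) / 2 * Real.log S.p) :
    S.HFinalHalf (h := h) (Lb := Lb) J S₀ t DmaxH MmaxH := by
  have hH : 1 ≤ heightProd S.all := CW77.one_le_heightProd _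
  have hQ : 0 < 4 * DmaxH ^ 2 * MmaxH * heightProd S.all ^ 3 := by positivity
  have hrhs : DmaxH / (4 * DmaxH ^ 2 * MmaxH * heightProd S.all ^ 3) ^ (2 ^ (S.d + 1)) =
      Real.exp (Real.log DmaxH -
        (2 : ℝ) ^ (S.d + 1) * Real.log (4 * DmaxH ^ 2 * MmaxH * heightProd S.all ^ 3)) := by
    have hc : (2 : ℝ) ^ (S.d + 1) * Real.log (4 * DmaxH ^ 2 * MmaxH * heightProd S.all ^ 3) =
        Real.log ((4 * DmaxH ^ 2 * MmaxH * heightProd S.all ^ 3) ^ (2 ^ (S.d + 1))) := by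
      rw [Real.log_pow]; push_cast; ring
    rw [hc, Real.exp_sub, Real.exp_log hD, Real.exp_log (pow_pos hQ _)]
  unfold HFinalHalf
  rw [hrhs]
  refine max_lt ?_ ?_
  · rcases (norm_nonneg S.Λ₀).eq_or_lt with h0 | hpos
    · rw [← h0]; simp [Real.exp_pos]
    · have e1 : (S.p : ℝ) ^ (h * Lb / (S.p - 1)) * ‖S.Λ₀‖ * (S.p : ℝ) ^ ((t - 1) / (S.p - 1)) *
          (S.p : ℝ) ^ condExp S.p (2 ^ (S.d + J) * S₀ / 2) t =
          Real.exp (((h * Lb / (S.p - 1) : ℕ) : ℝ) * Real.log S.p + Real.log ‖S.Λ₀‖ +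
            (((t - 1) / (S.p - 1) : ℕ) : ℝ) * Real.log S.p +
            (condExp S.p (2 ^ (S.d + J) * S₀ / 2) t : ℝ) * Real.log S.p) := by
        rw [S.natPow_eq_exp', S.natPow_eq_exp', S.natPow_eq_exp', ← Real.exp_log hpos]
        simp only [← Real.exp_add, Real.log_exp]
      rw [e1, Real.exp_lt_exp]
      have hlog : Real.log ‖S.Λ₀‖ ≤ -U := by
        have := Real.log_le_log hpos hΛ; rwa [Real.log_exp] at this
      push_cast at h1 ⊢
      linarith
  · have e2 : (S.p : ℝ) ^ (h * Lb) / Real.sqrt S.p ^ ((2 ^ (S.d + J) * S₀ / 2) * t) =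
        Real.exp (((h * Lb : ℕ) : ℝ) * Real.log S.p -
          (((2 ^ (S.d + J) * S₀ / 2) * t : ℕ) : ℝ) / 2 * Real.log S.p) := by
      rw [S.natPow_eq_exp', S.sqrt_pow_eq_exp', ← Real.exp_sub]
    rw [e2, Real.exp_lt_exp]
    linarith

/-! ### J2 at the half points: `HSizesHalf` in closed form (sizes from `PadicW80SizesC`) -/

/-- `|rHalf|` of the signed set-up is `|rHalf♭|` (real casts). [folklore] -/
theorem abs_cast_rHalf_eq_flat (J₀ J : ℕ) (u : Idx S.d h Lb) (τ : Tau S.d) (s : ℕ) :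
    |(S.toQ.rHalf J₀ J u τ s : ℝ)| = |(S.toQ.flat.rHalf J₀ J u τ s : ℝ)| := by
  rw [← Rat.cast_abs, ← Rat.cast_abs, S.toQ.abs_rHalf]

variable {S}
variable {P : PadicW80Par S.d} (hy : S.toQ.flat.SizeHyp P.Vs P.Vel P.Wb)
include hy


/-- **J2, the archimedean sizes at the half points in closed form**: `Dhalf♭ ≤ DmaxH` and
`∑_{T'}|classVec(T')| ≤ MmaxH` for every `p` of level `J < J₀` with `|p| ≤ Pint ≤ PrV`. [folklore] -/
theorem hSizesHalf_of_hyp {J : ℕ} (hJ : J < P.J₀p) {Pint : ℤ} (hPint : (Pint : ℝ) ≤ P.PrVp) :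
    S.HSizesHalf (h := P.hparp) (Lb := P.Lbp) P.J₀p J P.Lp P.Lθp P.S₀p P.Tp Pint P.DmaxHp P.MmaxHp := by
  refine ⟨P.one_le_MmaxHp, ?_⟩
  intro p inv s hs _hodd τ hτ
  have hPr : (0 : ℝ) ≤ P.PrVp := by linarith [P.one_le_PrVp]
  have hτT : tauNorm τ ≤ P.Tp := by have := Nat.div_le_self P.Tp (2 ^ (J + 1)); omega
  refine ⟨?_, ?_⟩
  · have := hy.Dhalf_le_p hJ hτT hs
    unfold PadicW80Par.DmaxHp PadicW80Par.Efacp; exact this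
  · have hcard : ((S.toQ.flat.box (h := P.hparp) (Lb := P.Lbp) P.Lp P.Lθp J).card : ℝ) ≤ P.𝔅p :=
      S.toQ.flat.card_box_le_𝔅_p P J
    have key := S.toQ.sum_abs_classVec_le_card P.J₀p J (S.toQ.flat.box (h := P.hparp) (Lb := P.Lbp) P.Lp P.Lθp J)
      p τ s (Rmax := P.DmaxHp) hPr
      (fun u _ => le_trans (by exact_mod_cast inv.bound u) hPint)
      (fun u hu => by
        rw [S.abs_cast_rHalf_eq_flat]
        have := hy.abs_rHalf_le_p hJ hu hτT hs
        unfold PadicW80Par.DmaxHp PadicW80Par.Efacp; exact this)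
    refine key.trans ?_
    have hR0 : (0 : ℝ) ≤ P.DmaxHp := by linarith [P.one_le_DmaxHp]
    unfold PadicW80Par.MmaxHp
    exact mul_le_mul_of_nonneg_right (mul_le_mul_of_nonneg_right hcard hPr) hR0

end Literature.NumberTheory.Transcendental.PadicCW77.Setup

end
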